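import Summits.CriticalPhenomena.CardyFormulaZ2.Theorems.CardyComplexConeEdgePrecompactUFRSFlatThreeStrandDichotomyTools
import Summits.CriticalPhenomena.CardyFormulaZ2.Theorems.CardyComplexConeEdgePrecompactUFRSHalfPlaneLooseTwoArm

/-!
# The flat three-strand decay HT from the dichotomy-extraction lemma
(line `qkz-strip-boundary-arm` of crux `CardyComplexCone.EdgePrecompact`, stmt-CriticalPhenomena-11387;
registered conditional form `ufrs_rect_flatThreeStrandDecay_of_dichotomy` of the bridge
`ufrs_rect_flatThreeStrandDecay` (HT); worker W-HT of lead c5, wave 4)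

## The statement

HT: for an axis-parallel rectangle `D`, `z ∈ D` within `s` of `∂D` (`η ≤ s`), an admissible
fine-mesh datum `E` of `D`, a shift `w` with `‖E.δ w‖ < η` and all marked edges of `E` and of
`shiftData E w` at distance `≥ 2S` from `z`: `P_{1/2}(ufrsStrands E w z 3 s S) ≤ C (s/S)^{1+α₁}`.
This file proves HT from the deterministic DICHOTOMY `ufrs_rect_threeStrands_dichotomy`
(registered, open; the redesign of the deterministic half for MIXED tags after the refutation of
`ufrs_rect_strandsHpArms`, see `…UFRSStrandsHpArmsPure.lean` for the pure case): for three
corner-disjoint strands across `A(z; s, S)` and a window `t ≥ 2s`, either (GOOD) the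
`φ`-relabelled configuration has three loose genuine half-plane arms from the window `≍ t` to
reach `≍ S`, or (BAD) at some dyadic level `ρ = S/2^{k+1} ≥ Λ₀ t` — the scale of the first fake
touchdown of the strand whose open side faces an interior sector — there are loose arms at `z`
to reach `≍ ρ` (read inside `B(z, ρ/2)`), loose arms in a window `≍ η` at one of `≤ N₀ ρ/η` grid
points `p` (read in the shell `(ρ/2, 3ρ)`), and three strands across `A(z; 4ρ, S)`.

## The proof (`strands_decay_induction_HT4`)

Multi-scale induction on the number of dyadic scales between the inner and the outer radius,
over inner radii `s ≥ s₀ := max (s, Λ η)` with window `t = 2s`, for the fixed outer radius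
`S' = min (S, c₀)`. With `f(s) = P(ufrsStrands E w z 3 s S')`, the unconditional loose
three-arm bound HT-B (`hpLooseArms_three_decay_of_two hpLooseArms_two_decay`, exponent `1+α`,
transported to frames and to the scale format by `real_frameArms_le_HT4`) and the three-slot
independence (`real_inter3_HT4`) give
`f(s) ≤ C'(K_c t/S')^{1+α} + Σ_ρ (N₀ ρ/η) · C'(K_c t/ρ)^{1+α} · C'(K_c η/ρ)^{1+α} · f(4ρ)`;
inserting the induction hypothesis `f(4ρ) ≤ C₁ (4ρ/S')^{1+α₁}` (`α₁ = α/2`) each level becomes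
`A C₁ (η/t)^α (t/S')^{1+α₁} (t/ρ)^{3α/2}` (`level_term_le_HT4`), the levels sum geometrically
(`levels_sum_le_HT4`), and `(η/t)^α ≤ (2Λ)^{-α}` because `s ≥ Λ η`: the recursive factor is
`A (2Λ)^{-α} Σ₀ 2^{1+α₁} ≤ 1/2` for the choice `Λ^α ≥ 4 A Σ₀ 2^{1+α₁}`, and the GOOD and trivial
(`S' ≤ 2K₀ s`) regimes fix `C₁`. (Running the induction down to `s ≍ η` instead would cost the
factor `Λ^{1+α₁-α}`, which does not close; the radii `η ≤ s < Λη` are recovered at the end by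
monotonicity of the strand event in the inner radius, at the price `Λ^{1+α₁}` in the constant.)
Finally `S > width + height + 1` is the empty regime (`ufrsStrands_rect_eq_empty`) and
`S ≤ L' S'` converts the outer radius back.

References: G. F. Lawler, O. Schramm, W. Werner, Electron. J. Probab. 7 (2002), App. A;
P. Nolin, Electron. J. Probab. 13 (2008), §4; H. Kesten, Probab. Theory Related Fields 73 (1986)
(multi-scale arm bookkeeping); G. Grimmett, *Percolation* (1999), §2.2.
-/

namespace Summit.CriticalPhenomena.CardyFormulaZ2.Cruxes.EdgePrecompact.QkzStripBoundaryArm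

open MeasureTheory Filter Set Metric
open scoped Topology BigOperators Pointwise
open Literature.Probability.LatticeModels Literature.Probability.Percolation
open Literature.Probability.RandomPlanarGeometry (DobrushinDomain)
open Summit.CriticalPhenomena.CardyFormulaZ2.Theses.CardyComplexCone

noncomputable section

/-! ## The induction over the inner radius -/

/-- **The multi-scale induction.** Fix the datum `E`, the shift `w`, the centre `z`, the outer
radius `S'` and the collar width `η ≥ E.δ`; assume the dichotomy at every inner radius `s ≥ s₀`
(`s₀ ≥ Λ η`) with window `t = 2s`, and the loose three-arm bound with constants `C, α, K`. If
`Λ, C₁` satisfy the smallness condition `hsmall` (recursive factor `≤ 1/2`) and `C₁` dominates the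
trivial regime and the GOOD term, then for every number of scales `n`: `S' ≤ 2^n s`, `s ≥ s₀`
imply `P(ufrsStrands E w z 3 s S') ≤ C₁ (s/S')^{1+α₁}`, `α₁ = α/2`. -/
theorem strands_decay_induction_HT4 (E : DiscreteDobrushin) (w : Site 2) (z : ℂ)
    {η S' s₀ K₀ N₀ Λ₀ C α Λ C₁ α₁ : ℝ} {K : ℕ}
    (hδ : 0 < E.δ) (hδη : E.δ ≤ η) (hη : 0 < η) (hΛ1 : 1 ≤ Λ) (hs₀ : Λ * η ≤ s₀) (hS' : 0 < S')
    (hK₀ : 1 ≤ K₀) (hN₀ : 0 ≤ N₀) (hΛ₀ : 1 ≤ Λ₀) (hα : 0 < α) (hα₁ : α₁ = α / 2) (hK : 1 ≤ K)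
    (hBd : ∀ (j : ℤ) (m n R : ℕ), 1 ≤ m → m ≤ n → K * n ≤ R →
      (bondPercolation (zdGraph 2) half).real (hpLooseArms j 3 m R) ≤ C * ((m : ℝ) / n) ^ (1 + α))
    (hsmall : (N₀ * (max C 1 * (2 * K * K₀ ^ 2) ^ (1 + α)) * (max C 1 * (2 * K * K₀ ^ 2) ^ (1 + α)) * (4 : ℝ) ^ (1 + α₁)) *
      ((1 / (2 * Λ)) ^ α * (1 - (1 / 2 : ℝ) ^ (2 * α - α₁))⁻¹ * (2 : ℝ) ^ (1 + α₁)) ≤ 1 / 2)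
    (hC₁M : (2 * K₀) ^ (1 + α₁) ≤ C₁) (hC₁G : 2 * (max C 1 * (2 * K * K₀ ^ 2 * 2) ^ (1 + α)) ≤ C₁)
    (hdich : ∀ (s t : ℝ), s₀ ≤ s → 2 * s ≤ t → K₀ * t ≤ S' → ∃ (φ : zdGraph 2 ≃g zdGraph 2) (j : ℤ) (m RS : ℕ) (Rz : ℕ → ℕ) (P : ℕ → Finset (Site 2)) (ψ : ℕ → Site 2 → zdGraph 2 ≃g zdGraph 2) (jp : ℕ → Site 2 → ℤ) (mp Rp : ℕ → Site 2 → ℕ), (1 ≤ m ∧ (m : ℝ) * E.δ ≤ K₀ * t ∧ S' ≤ K₀ * RS * E.δ) ∧ (∀ k : ℕ, Λ₀ * t ≤ S' / 2 ^ (k + 1) → S' / 2 ^ (k + 1) ≤ K₀ * Rz k * E.δ ∧ ((P k).card : ℝ) ≤ N₀ * (S' / 2 ^ (k + 1)) / η ∧ (∀ a ∈ Z2HalfPlane.armSites j 1 (Rz k), dist (meshPoint E.δ (φ.symm a)) z < S' / 2 ^ (k + 1) / 2) ∧ ∀ p ∈ P k, 1 ≤ mp k p ∧ (mp k p : ℝ)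 * E.δ ≤ K₀ * η ∧ S' / 2 ^ (k + 1) ≤ K₀ * Rp k p * E.δ ∧ ∀ a ∈ Z2HalfPlane.armSites (jp k p) 1 (Rp k p), S' / 2 ^ (k + 1) / 2 < dist (meshPoint E.δ ((ψ k p).symm a)) z ∧ dist (meshPoint E.δ ((ψ k p).symm a)) z < 3 * (S' / 2 ^ (k + 1))) ∧ ∀ ω : BondConfig (Site 2), ω ∈ ufrsStrands E w z 3 s S' → BondConfig.relabel (sym2Equiv φ.toEquiv) ω ∈ hpLooseArms j 3 m RS ∨ ∃ k : ℕ, Λ₀ * t ≤ S' / 2 ^ (k + 1) ∧ ∃ p ∈ P k, BondConfig.relabel (sym2Equiv φ.toEquiv) ω ∈ hpLooseArms j 3 m (Rz k) ∧ BondConfig.relabel (sym2Equiv (ψ k p).toEquiv) ω ∈ hpLooseArms (jp k p) 3 (mp k p) (Rp k p) ∧ ω ∈ ufrsStrands E w z 3 (4 * (S' / 2 ^ (k + 1))) S') :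
    ∀ (n : ℕ) (s : ℝ), s₀ ≤ s → S' ≤ 2 ^ n * s →
      (bondPercolation (zdGraph 2) half).real (ufrsStrands E w z 3 s S') ≤ C₁ * (s / S') ^ (1 + α₁) := by
  set μ := bondPercolation (zdGraph 2) half with hμ
  have hs₀pos : 0 < s₀ := lt_of_lt_of_le (by positivity) hs₀
  have hα₁pos : 0 < α₁ := by rw [hα₁]; positivity
  have hα₁le : α₁ ≤ α := by rw [hα₁]; linarith
  have hγ : 0 < 2 * α - α₁ := by rw [hα₁]; linarith
  have hC'0 : (0 : ℝ) ≤ max C 1 := le_trans zero_le_one (le_max_right _ _)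
  have hKc0 : (0 : ℝ) ≤ 2 * K * K₀ ^ 2 := by positivity
  have hC₁1 : 1 ≤ C₁ := le_trans (Real.one_le_rpow (by linarith) (by linarith)) hC₁M
  have hC₁0 : 0 ≤ C₁ := by linarith
  have hηΛ : η ≤ Λ * η := le_mul_of_one_le_left hη.le hΛ1
  -- the trivial regime `S' ≤ 2 K₀ s`
  have htriv : ∀ s : ℝ, 0 < s → S' ≤ 2 * K₀ * s →
      μ.real (ufrsStrands E w z 3 s S') ≤ C₁ * (s / S') ^ (1 + α₁) := by
    intro s hs hle
    have hratio : 1 ≤ 2 * K₀ * (s / S') := by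
      rw [mul_div_assoc', le_div_iff₀ hS', one_mul]; exact hle
    calc μ.real (ufrsStrands E w z 3 s S') ≤ 1 := measureReal_le_one
      _ ≤ (2 * K₀ * (s / S')) ^ (1 + α₁) := Real.one_le_rpow hratio (by linarith)
      _ = (2 * K₀) ^ (1 + α₁) * (s / S') ^ (1 + α₁) := Real.mul_rpow (by positivity) (by positivity)
      _ ≤ C₁ * (s / S') ^ (1 + α₁) := mul_le_mul_of_nonneg_right hC₁M (by positivity)
  intro n
  induction n with
  | zero =>
    intro s hs hSs
    have hspos : 0 < s := lt_of_lt_of_le hs₀pos hs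
    refine htriv s hspos ?_
    rw [pow_zero, one_mul] at hSs
    nlinarith
  | succ n ih =>
    intro s hs hSn
    have hspos : 0 < s := lt_of_lt_of_le hs₀pos hs
    have hηs : η ≤ s := hηΛ.trans (hs₀.trans hs)
    rcases le_or_gt S' (2 * K₀ * s) with hle | hgt
    · exact htriv s hspos hle
    -- the main regime: window `t = 2 s`
    have htpos : 0 < 2 * s := by positivity
    have hKt : K₀ * (2 * s) ≤ S' := by linarith
    have hsS : s / S' ≤ 1 := by
      rw [div_le_one hS']; nlinarith
    obtain ⟨φ, j, m, RS, Rz, P, ψ, jp, mp, Rp, ⟨hm1, hmt, hSRS⟩, hlev, hcover⟩ := hdich s (2 * s) hs le_rfl hKt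
    -- admissible levels
    set Adm : Finset ℕ := (Finset.range (n + 1)).filter (fun k => Λ₀ * (2 * s) ≤ S' / 2 ^ (k + 1)) with hAdm
    have hAdm_mem : ∀ k ∈ Adm, Λ₀ * (2 * s) ≤ S' / 2 ^ (k + 1) := fun k hk => (Finset.mem_filter.1 hk).2
    have hρt : ∀ k ∈ Adm, 2 * s ≤ S' / 2 ^ (k + 1) := fun k hk =>
      le_trans (le_mul_of_one_le_left htpos.le hΛ₀) (hAdm_mem k hk)
    have hρpos : ∀ k : ℕ, 0 < S' / 2 ^ (k + 1) := fun k => by positivity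
    -- the cover
    have hsub : ufrsStrands E w z 3 s S' ⊆ BondConfig.relabel (sym2Equiv φ.toEquiv) ⁻¹' hpLooseArms j 3 m RS ∪
        ⋃ k ∈ Adm, ⋃ p ∈ P k, (BondConfig.relabel (sym2Equiv φ.toEquiv) ⁻¹' hpLooseArms j 3 m (Rz k) ∩
          BondConfig.relabel (sym2Equiv (ψ k p).toEquiv) ⁻¹' hpLooseArms (jp k p) 3 (mp k p) (Rp k p) ∩
          ufrsStrands E w z 3 (4 * (S' / 2 ^ (k + 1))) S') := by
      intro ω hω
      rcases hcover ω hω with hG | ⟨k, hk, p, hp, hZ, hH, hO⟩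
      · exact Or.inl hG
      · have hkA : k ∈ Adm := Finset.mem_filter.2 ⟨Finset.mem_range.2 (level_lt_HT4 hspos hΛ₀ hSn hk), hk⟩
        exact Or.inr (Set.mem_iUnion₂.2 ⟨k, hkA, Set.mem_iUnion₂.2 ⟨p, hp, ⟨hZ, hH⟩, hO⟩⟩)
    -- the GOOD term
    have hGOOD : μ.real (BondConfig.relabel (sym2Equiv φ.toEquiv) ⁻¹' hpLooseArms j 3 m RS) ≤
        max C 1 * (2 * K * K₀ ^ 2 * (2 * s / S')) ^ (1 + α) :=
      real_frameArms_le_HT4 hα hK hBd hK₀ hδ htpos hS' φ j hm1 hmt hSRS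
    have hG : max C 1 * (2 * K * K₀ ^ 2 * (2 * s / S')) ^ (1 + α) ≤ C₁ / 2 * (s / S') ^ (1 + α₁) := by
      rw [show 2 * (K : ℝ) * K₀ ^ 2 * (2 * s / S') = (2 * K * K₀ ^ 2 * 2) * (s / S') by ring,
        Real.mul_rpow (by positivity) (by positivity)]
      have h1 : (s / S') ^ (1 + α) ≤ (s / S') ^ (1 + α₁) :=
        Real.rpow_le_rpow_of_exponent_ge (by positivity) hsS (by linarith)
      calc max C 1 * ((2 * K * K₀ ^ 2 * 2) ^ (1 + α) * (s / S') ^ (1 + α))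
          = (max C 1 * (2 * K * K₀ ^ 2 * 2) ^ (1 + α)) * (s / S') ^ (1 + α) := by ring
        _ ≤ (max C 1 * (2 * K * K₀ ^ 2 * 2) ^ (1 + α)) * (s / S') ^ (1 + α₁) :=
            mul_le_mul_of_nonneg_left h1 (by positivity)
        _ ≤ C₁ / 2 * (s / S') ^ (1 + α₁) := mul_le_mul_of_nonneg_right (by linarith) (by positivity)
    -- each BAD term: three slots
    have hterm : ∀ k ∈ Adm, ∀ p ∈ P k,
        μ.real (BondConfig.relabel (sym2Equiv φ.toEquiv) ⁻¹' hpLooseArms j 3 m (Rz k) ∩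
          BondConfig.relabel (sym2Equiv (ψ k p).toEquiv) ⁻¹' hpLooseArms (jp k p) 3 (mp k p) (Rp k p) ∩
          ufrsStrands E w z 3 (4 * (S' / 2 ^ (k + 1))) S') ≤
        (max C 1 * (2 * K * K₀ ^ 2 * (2 * s / (S' / 2 ^ (k + 1)))) ^ (1 + α)) *
        (max C 1 * (2 * K * K₀ ^ 2 * (η / (S' / 2 ^ (k + 1)))) ^ (1 + α)) *
        (C₁ * (4 * (S' / 2 ^ (k + 1)) / S') ^ (1 + α₁)) := by
      intro k hk p hp
      obtain ⟨hRz, -, hlocZ, hPk⟩ := hlev k (hAdm_mem k hk)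
      obtain ⟨hmp1, hmpη, hRp, hlocH⟩ := hPk p hp
      have h2δ : 2 * E.δ ≤ S' / 2 ^ (k + 1) := by linarith [hρt k hk]
      refine real_inter3_le_HT4 E hδ w z 3 h2δ
        (ufrs_frameArms_local φ j 3 m (Rz k) (fun x => dist (meshPoint E.δ x) z < S' / 2 ^ (k + 1) / 2) hlocZ)
        (ufrs_frameArms_local (ψ k p) (jp k p) 3 (mp k p) (Rp k p)
          (fun x => S' / 2 ^ (k + 1) / 2 < dist (meshPoint E.δ x) z ∧
            dist (meshPoint E.δ x) z < 3 * (S' / 2 ^ (k + 1))) hlocH)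
        (measurableSet_frameArms_HT4 φ j 3 m (Rz k))
        (measurableSet_frameArms_HT4 (ψ k p) (jp k p) 3 (mp k p) (Rp k p))
        (real_frameArms_le_HT4 hα hK hBd hK₀ hδ htpos (hρpos k) φ j hm1 hmt hRz)
        (real_frameArms_le_HT4 hα hK hBd hK₀ hδ hη (hρpos k) (ψ k p) (jp k p) hmp1 hmpη hRp) ?_
      -- the outer strands: the induction hypothesis at inner radius `4 ρ_k`
      refine ih (4 * (S' / 2 ^ (k + 1))) ?_ ?_
      · linarith [hρt k hk]
      · calc S' ≤ 2 ^ (n + 1) * s := hSn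
          _ = 2 ^ n * (2 * s) := by ring
          _ ≤ 2 ^ n * (4 * (S' / 2 ^ (k + 1))) := by
              refine mul_le_mul_of_nonneg_left ?_ (by positivity)
              linarith [hρt k hk, hρpos k]
    -- each level
    set A : ℝ := N₀ * (max C 1 * (2 * K * K₀ ^ 2) ^ (1 + α)) * (max C 1 * (2 * K * K₀ ^ 2) ^ (1 + α)) *
      (4 : ℝ) ^ (1 + α₁) with hA
    have hA0 : 0 ≤ A := by rw [hA]; positivity
    have hlevel : ∀ k ∈ Adm, ∑ p ∈ P k,
        μ.real (BondConfig.relabel (sym2Equiv φ.toEquiv) ⁻¹' hpLooseArms j 3 m (Rz k) ∩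
          BondConfig.relabel (sym2Equiv (ψ k p).toEquiv) ⁻¹' hpLooseArms (jp k p) 3 (mp k p) (Rp k p) ∩
          ufrsStrands E w z 3 (4 * (S' / 2 ^ (k + 1))) S') ≤
        A * C₁ * ((η / (2 * s)) ^ α * (2 * s / S') ^ (1 + α₁) * (2 * s / (S' / 2 ^ (k + 1))) ^ (2 * α - α₁)) := by
      intro k hk
      obtain ⟨-, hcard, -, -⟩ := hlev k (hAdm_mem k hk)
      exact level_term_le_HT4 (P k) _ hη htpos (hρpos k) hS' hC'0 hKc0 hC₁0 hcard (hterm k hk)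
    -- the sum over the levels
    set Sg : ℝ := (1 - (1 / 2 : ℝ) ^ (2 * α - α₁))⁻¹ with hSg
    have hSg0 : 0 ≤ Sg := by
      rw [hSg]; exact inv_nonneg.2 (sub_nonneg.2 (Real.rpow_le_one (by norm_num) (by norm_num) hγ.le))
    have hB : ∑ k ∈ Adm, ∑ p ∈ P k,
        μ.real (BondConfig.relabel (sym2Equiv φ.toEquiv) ⁻¹' hpLooseArms j 3 m (Rz k) ∩
          BondConfig.relabel (sym2Equiv (ψ k p).toEquiv) ⁻¹' hpLooseArms (jp k p) 3 (mp k p) (Rp k p) ∩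
          ufrsStrands E w z 3 (4 * (S' / 2 ^ (k + 1))) S') ≤ C₁ / 2 * (s / S') ^ (1 + α₁) := by
      refine (Finset.sum_le_sum hlevel).trans ?_
      have e : ∀ k : ℕ, A * C₁ * ((η / (2 * s)) ^ α * (2 * s / S') ^ (1 + α₁) * (2 * s / (S' / 2 ^ (k + 1))) ^ (2 * α - α₁)) =
          (A * C₁ * ((η / (2 * s)) ^ α * (2 * s / S') ^ (1 + α₁))) * (2 * s / (S' / 2 ^ (k + 1))) ^ (2 * α - α₁) :=
        fun k => by ring
      rw [Finset.sum_congr rfl fun k _ => e k]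
      have hB0 : 0 ≤ A * C₁ * ((η / (2 * s)) ^ α * (2 * s / S') ^ (1 + α₁)) := by positivity
      refine (levels_sum_le_HT4 hΛ₀ htpos hS' hγ hB0 (n + 1)).trans ?_
      have hηt : (η / (2 * s)) ^ α ≤ (1 / (2 * Λ)) ^ α := by
        refine Real.rpow_le_rpow (by positivity) ?_ hα.le
        rw [div_le_div_iff₀ (by positivity) (by positivity)]
        nlinarith [hs₀.trans hs]
      have e2 : (2 * s / S') ^ (1 + α₁) = (2 : ℝ) ^ (1 + α₁) * (s / S') ^ (1 + α₁) := by
        rw [show 2 * s / S' = 2 * (s / S') by ring, Real.mul_rpow (by norm_num) (by positivity)]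
      rw [e2]
      calc A * C₁ * ((η / (2 * s)) ^ α * ((2 : ℝ) ^ (1 + α₁) * (s / S') ^ (1 + α₁))) * Sg
          = C₁ * (s / S') ^ (1 + α₁) * (A * ((η / (2 * s)) ^ α * Sg * (2 : ℝ) ^ (1 + α₁))) := by ring
        _ ≤ C₁ * (s / S') ^ (1 + α₁) * (A * ((1 / (2 * Λ)) ^ α * Sg * (2 : ℝ) ^ (1 + α₁))) := by
            refine mul_le_mul_of_nonneg_left (mul_le_mul_of_nonneg_left ?_ hA0) (by positivity)
            exact mul_le_mul_of_nonneg_right (mul_le_mul_of_nonneg_right hηt hSg0) (by positivity)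
        _ ≤ C₁ * (s / S') ^ (1 + α₁) * (1 / 2) := mul_le_mul_of_nonneg_left hsmall (by positivity)
        _ = C₁ / 2 * (s / S') ^ (1 + α₁) := by ring
    have hbad : μ.real (⋃ k ∈ Adm, ⋃ p ∈ P k, (BondConfig.relabel (sym2Equiv φ.toEquiv) ⁻¹' hpLooseArms j 3 m (Rz k) ∩
          BondConfig.relabel (sym2Equiv (ψ k p).toEquiv) ⁻¹' hpLooseArms (jp k p) 3 (mp k p) (Rp k p) ∩
          ufrsStrands E w z 3 (4 * (S' / 2 ^ (k + 1))) S')) ≤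
        ∑ k ∈ Adm, ∑ p ∈ P k,
          μ.real (BondConfig.relabel (sym2Equiv φ.toEquiv) ⁻¹' hpLooseArms j 3 m (Rz k) ∩
            BondConfig.relabel (sym2Equiv (ψ k p).toEquiv) ⁻¹' hpLooseArms (jp k p) 3 (mp k p) (Rp k p) ∩
            ufrsStrands E w z 3 (4 * (S' / 2 ^ (k + 1))) S') :=
      (measureReal_biUnion_finset_le Adm _).trans (Finset.sum_le_sum fun k _ => measureReal_biUnion_finset_le (P k) _)
    refine (measureReal_mono hsub (measure_ne_top _ _)).trans ((measureReal_union_le _ _).trans ?_)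
    refine (add_le_add (hGOOD.trans hG) (hbad.trans hB)).trans_eq ?_
    ring

/-! ## HT from the dichotomy -/

/-- **HT from the dichotomy-extraction lemma** (registered conditional form
`ufrs_rect_flatThreeStrandDecay_of_dichotomy` of the bridge `ufrs_rect_flatThreeStrandDecay`):
the deterministic dichotomy `ufrs_rect_threeStrands_dichotomy` (hypothesis, verbatim its
registered signature) implies the flat three-strand decay HT verbatim, with exponent `1 + α/2`
where `α` is the exponent of the unconditional loose three-arm bound
`hpLooseArms_three_decay_of_two hpLooseArms_two_decay`. See the module docstring. -/
theorem ufrs_rect_flatThreeStrandDecay_of_dichotomy : (∀ (D : DobrushinDomain), (∃ x₀ x₁ y₀ y₁ : ℝ, x₀ < x₁ ∧ y₀ < y₁ ∧ D.carrier = Set.Ioo x₀ x₁ ×ℂ Set.Ioo y₀ y₁) → ∃ (K₀ c₀ N₀ Λ₀ : ℝ), 1 ≤ K₀ ∧ 0 < c₀ ∧ 0 < N₀ ∧ 1 ≤ Λ₀ ∧ ∀ (η : ℝ), 0 < η → ∀ E : DiscreteDobrushin, E.Ω = D.carrier → E.IsZdAdmissible → E.δ ≤ η → ∀ w : Site 2,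 ‖meshPoint E.δ w‖ < η → ∀ (z : ℂ) (s S t : ℝ), z ∈ D.carrier → infDist z D.carrierᶜ ≤ s → η ≤ s → 2 * s ≤ t → K₀ * t ≤ S → S ≤ c₀ → (∀ e₀ : Sym2 (Site 2), (e₀ ∈ E.zdABEdges ∨ e₀ ∈ (shiftData E w).zdABEdges) → 2 * S ≤ dist (medialPoint E.δ e₀) z) → ∃ (φ : zdGraph 2 ≃g zdGraph 2) (j : ℤ) (m RS : ℕ) (Rz : ℕ → ℕ) (P : ℕ → Finset (Site 2)) (ψ : ℕ → Site 2 → zdGraph 2 ≃g zdGraph 2) (jp : ℕ → Site 2 → ℤ) (mp Rp : ℕ → Site 2 → ℕ), (1 ≤ m ∧ (m : ℝ) * E.δ ≤ K₀ * t ∧ S ≤ K₀ * RS * E.δ) ∧ (∀ k : ℕ, Λ₀ * t ≤ S / 2 ^ (k + 1) → S / 2 ^ (k + 1) ≤ K₀ * Rz k * E.δ ∧ ((P k).card : ℝ) ≤ N₀ * (S / 2 ^ (k + 1)) / η ∧ (∀ a ∈ Z2HalfPlane.armSites j 1 (Rz k), dist (meshPoint E.δ (φ.symm a)) z < S / 2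 ^ (k + 1) / 2) ∧ ∀ p ∈ P k, 1 ≤ mp k p ∧ (mp k p : ℝ) * E.δ ≤ K₀ * η ∧ S / 2 ^ (k + 1) ≤ K₀ * Rp k p * E.δ ∧ ∀ a ∈ Z2HalfPlane.armSites (jp k p) 1 (Rp k p), S / 2 ^ (k + 1) / 2 < dist (meshPoint E.δ ((ψ k p).symm a)) z ∧ dist (meshPoint E.δ ((ψ k p).symm a)) z < 3 * (S / 2 ^ (k + 1))) ∧ ∀ ω : BondConfig (Site 2), ω ∈ ufrsStrands E w z 3 s S → BondConfig.relabel (sym2Equiv φ.toEquiv) ω ∈ hpLooseArms j 3 m RS ∨ ∃ k : ℕ, Λ₀ * t ≤ S / 2 ^ (k + 1) ∧ ∃ p ∈ P k, BondConfig.relabel (sym2Equiv φ.toEquiv) ω ∈ hpLooseArms j 3 m (Rz k) ∧ BondConfig.relabel (sym2Equiv (ψ k p).toEquiv) ω ∈ hpLooseArms (jp k p) 3 (mp k p) (Rp k p) ∧ ω ∈ ufrsStrands E w z 3 (4 * (S / 2 ^ (k + 1))) S) → ∀ (D : DobrushinDomain), (∃ x₀ x₁ y₀ y₁ : ℝ,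 x₀ < x₁ ∧ y₀ < y₁ ∧ D.carrier = Set.Ioo x₀ x₁ ×ℂ Set.Ioo y₀ y₁) → ∃ C α : ℝ, 0 < C ∧ 0 < α ∧ ∃ η₀ > (0:ℝ), ∀ η : ℝ, 0 < η → η < η₀ → ∃ δ₀ > (0:ℝ), ∀ E : DiscreteDobrushin, E.Ω = D.carrier → E.IsZdAdmissible → E.δ < δ₀ → ∀ w : Site 2, ‖meshPoint E.δ w‖ < η → ∀ (z : ℂ) (s S : ℝ), z ∈ D.carrier → infDist z D.carrierᶜ ≤ s → η ≤ s → 0 < S → (∀ e₀ : Sym2 (Site 2), (e₀ ∈ E.zdABEdges ∨ e₀ ∈ (shiftData E w).zdABEdges) → 2 * S ≤ dist (medialPoint E.δ e₀) z) → (bondPercolation (zdGraph 2) half).real (ufrsStrands E w z 3 s S) ≤ C * (s / S) ^ (1 + α) := by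
  intro hD D hDrect
  obtain ⟨x₀, x₁, y₀, y₁, hx, hy, hcar⟩ := hDrect
  obtain ⟨K₀, c₀, N₀, Λ₀, hK₀, hc₀, hN₀, hΛ₀, hd⟩ := hD D ⟨x₀, x₁, y₀, y₁, hx, hy, hcar⟩
  obtain ⟨C, α, hC, hα, K, hK, hBd⟩ := hpLooseArms_three_decay_of_two hpLooseArms_two_decay
  -- constants
  set α₁ : ℝ := α / 2 with hα₁
  have hα₁pos : 0 < α₁ := by rw [hα₁]; positivity
  have hγ : 0 < 2 * α - α₁ := by rw [hα₁]; linarith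
  set A : ℝ := N₀ * (max C 1 * (2 * K * K₀ ^ 2) ^ (1 + α)) * (max C 1 * (2 * K * K₀ ^ 2) ^ (1 + α)) *
    (4 : ℝ) ^ (1 + α₁) with hA
  set Sg : ℝ := (1 - (1 / 2 : ℝ) ^ (2 * α - α₁))⁻¹ with hSg
  have hq1 : (1 / 2 : ℝ) ^ (2 * α - α₁) < 1 := Real.rpow_lt_one (by norm_num) (by norm_num) hγ
  have hSgpos : 0 < Sg := by rw [hSg]; exact inv_pos.2 (by linarith)
  have hC1 : (1 : ℝ) ≤ max C 1 := le_max_right _ _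
  have hApos : 0 < A := by rw [hA]; positivity
  set B₀ : ℝ := 2 * (A * (Sg * (2 : ℝ) ^ (1 + α₁))) with hB₀
  have hB₀pos : 0 < B₀ := by rw [hB₀]; positivity
  set Λ : ℝ := max 1 (B₀ ^ (1 / α)) with hΛ
  have hΛ1 : 1 ≤ Λ := le_max_left _ _
  have hΛpos : 0 < Λ := by linarith
  set C₁ : ℝ := max ((2 * K₀) ^ (1 + α₁)) (2 * (max C 1 * (2 * K * K₀ ^ 2 * 2) ^ (1 + α))) with hC₁
  have hC₁M : (2 * K₀) ^ (1 + α₁) ≤ C₁ := le_max_left _ _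
  have hC₁G : 2 * (max C 1 * (2 * K * K₀ ^ 2 * 2) ^ (1 + α)) ≤ C₁ := le_max_right _ _
  have hC₁pos : 0 < C₁ := lt_of_lt_of_le (by positivity) hC₁M
  set L : ℝ := (x₁ - x₀) + (y₁ - y₀) + 1 with hL
  have hL1 : 1 ≤ L := by rw [hL]; linarith
  set L' : ℝ := max 1 (L / c₀) with hL'
  have hL'1 : 1 ≤ L' := le_max_left _ _
  have hLL' : L ≤ L' * c₀ := by
    have : L / c₀ ≤ L' := le_max_right _ _
    rwa [div_le_iff₀ hc₀] at this
  -- the smallness of the recursive factor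
  have hsmall : A * ((1 / (2 * Λ)) ^ α * Sg * (2 : ℝ) ^ (1 + α₁)) ≤ 1 / 2 := by
    have hΛα : B₀ ≤ Λ ^ α := by
      calc B₀ = (B₀ ^ (1 / α)) ^ α := by
            rw [← Real.rpow_mul hB₀pos.le, one_div_mul_cancel hα.ne', Real.rpow_one]
        _ ≤ Λ ^ α := Real.rpow_le_rpow (by positivity) (le_max_right _ _) hα.le
    have h1 : (1 / (2 * Λ)) ^ α ≤ (Λ ^ α)⁻¹ := by
      rw [← Real.inv_rpow hΛpos.le]
      refine Real.rpow_le_rpow (by positivity) ?_ hα.le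
      rw [inv_eq_one_div]
      exact one_div_le_one_div_of_le hΛpos (by linarith)
    have h2 : (Λ ^ α)⁻¹ ≤ B₀⁻¹ := inv_anti₀ hB₀pos hΛα
    have h3 : A * (Sg * (2 : ℝ) ^ (1 + α₁)) = B₀ / 2 := by rw [hB₀]; ring
    calc A * ((1 / (2 * Λ)) ^ α * Sg * (2 : ℝ) ^ (1 + α₁))
        ≤ A * (B₀⁻¹ * Sg * (2 : ℝ) ^ (1 + α₁)) := by
          refine mul_le_mul_of_nonneg_left ?_ hApos.le
          exact mul_le_mul_of_nonneg_right (mul_le_mul_of_nonneg_right (h1.trans h2) hSgpos.le) (by positivity)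
      _ = B₀⁻¹ * (A * (Sg * (2 : ℝ) ^ (1 + α₁))) := by ring
      _ = 1 / 2 := by rw [h3]; field_simp
  refine ⟨C₁ * (Λ * L') ^ (1 + α₁), α₁, by positivity, hα₁pos, 1 / 2, by norm_num, fun η hη hηlt => ?_⟩
  refine ⟨η, hη, fun E hEΩ hadm hδ w hw z s S hz hzs hηs hS hmarked => ?_⟩
  set μ := bondPercolation (zdGraph 2) half with hμ
  have hs : 0 < s := lt_of_lt_of_le hη hηs
  have hδpos : 0 < E.δ := hadm.delta_pos
  have hδη : E.δ ≤ η := hδ.le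
  have hzD : z ∈ Set.Ioo x₀ x₁ ×ℂ Set.Ioo y₀ y₁ := hcar ▸ hz
  -- the empty regime `S > L`
  rcases lt_or_ge L S with hfar | hSL
  · have hw1 : ‖meshPoint E.δ w‖ < 1 := by linarith
    rw [ufrsStrands_rect_eq_empty (hEΩ.trans hcar) hw1 (subset_closure hzD) (by norm_num)
      (by rw [hL] at hfar; exact hfar.le), measureReal_empty]
    positivity
  -- the outer radius `S' = min S c₀` and the inner radius `s₀ = max s (Λ η)`
  set S' : ℝ := min S c₀ with hS'
  have hS'S : S' ≤ S := min_le_left _ _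
  have hS'c : S' ≤ c₀ := min_le_right _ _
  have hS'pos : 0 < S' := lt_min hS hc₀
  have hSΛ : S ≤ L' * S' := by
    rcases le_total S c₀ with h | h
    · rw [hS', min_eq_left h]; exact le_mul_of_one_le_left hS.le hL'1
    · rw [hS', min_eq_right h]; linarith
  set s₀ : ℝ := max s (Λ * η) with hs₀
  have hs₀s : s ≤ s₀ := le_max_left _ _
  have hΛη : Λ * η ≤ s₀ := le_max_right _ _
  have hs₀Λ : s₀ ≤ Λ * s := max_le (le_mul_of_one_le_left hs.le hΛ1) (mul_le_mul_of_nonneg_left hηs hΛpos.le)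
  have hs₀pos : 0 < s₀ := lt_of_lt_of_le hs hs₀s
  -- the dichotomy along the induction
  have hdich : ∀ (s t : ℝ), s₀ ≤ s → 2 * s ≤ t → K₀ * t ≤ S' → ∃ (φ : zdGraph 2 ≃g zdGraph 2) (j : ℤ) (m RS : ℕ) (Rz : ℕ → ℕ) (P : ℕ → Finset (Site 2)) (ψ : ℕ → Site 2 → zdGraph 2 ≃g zdGraph 2) (jp : ℕ → Site 2 → ℤ) (mp Rp : ℕ → Site 2 → ℕ), (1 ≤ m ∧ (m : ℝ) * E.δ ≤ K₀ * t ∧ S' ≤ K₀ * RS * E.δ) ∧ (∀ k : ℕ, Λ₀ * t ≤ S' / 2 ^ (k + 1) → S' / 2 ^ (k + 1) ≤ K₀ * Rz k * E.δ ∧ ((P k).card : ℝ) ≤ N₀ * (S' / 2 ^ (k + 1)) / η ∧ (∀ a ∈ Z2HalfPlane.armSites j 1 (Rz k), dist (meshPoint E.δ (φ.symm a)) z < S' / 2 ^ (k + 1) / 2) ∧ ∀ p ∈ P k, 1 ≤ mp k p ∧ (mp k p : ℝ) * E.δ ≤ K₀ * η ∧ S' / 2 ^ (k + 1) ≤ K₀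 * Rp k p * E.δ ∧ ∀ a ∈ Z2HalfPlane.armSites (jp k p) 1 (Rp k p), S' / 2 ^ (k + 1) / 2 < dist (meshPoint E.δ ((ψ k p).symm a)) z ∧ dist (meshPoint E.δ ((ψ k p).symm a)) z < 3 * (S' / 2 ^ (k + 1))) ∧ ∀ ω : BondConfig (Site 2), ω ∈ ufrsStrands E w z 3 s S' → BondConfig.relabel (sym2Equiv φ.toEquiv) ω ∈ hpLooseArms j 3 m RS ∨ ∃ k : ℕ, Λ₀ * t ≤ S' / 2 ^ (k + 1) ∧ ∃ p ∈ P k, BondConfig.relabel (sym2Equiv φ.toEquiv) ω ∈ hpLooseArms j 3 m (Rz k) ∧ BondConfig.relabel (sym2Equiv (ψ k p).toEquiv) ω ∈ hpLooseArms (jp k p) 3 (mp k p) (Rp k p) ∧ ω ∈ ufrsStrands E w z 3 (4 * (S' / 2 ^ (k + 1))) S' := by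
    intro s₁ t h1 h2 h3
    have hmarked' : ∀ e₀ : Sym2 (Site 2), (e₀ ∈ E.zdABEdges ∨ e₀ ∈ (shiftData E w).zdABEdges) →
        2 * S' ≤ dist (medialPoint E.δ e₀) z := fun e₀ he₀ => by linarith [hmarked e₀ he₀]
    have hηs₁ : η ≤ s₁ := (le_mul_of_one_le_left hη.le hΛ1).trans (hΛη.trans h1)
    exact hd η hη E hEΩ hadm hδη w hw z s₁ S' t hz (hzs.trans (hs₀s.trans h1)) hηs₁ h2 h3 hS'c hmarked'
  have key := strands_decay_induction_HT4 E w z hδpos hδη hη hΛ1 hΛη hS'pos hK₀ hN₀.le hΛ₀ hα hα₁ hK hBd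
    hsmall hC₁M hC₁G hdich
  -- the number of scales
  set n : ℕ := ⌈S' / s₀⌉₊ with hn
  have hnS : S' ≤ 2 ^ n * s₀ := by
    have h1 : S' / s₀ ≤ n := Nat.le_ceil _
    have h2 : (n : ℝ) ≤ 2 ^ n := by exact_mod_cast (Nat.lt_two_pow_self (n := n)).le
    rw [div_le_iff₀ hs₀pos] at h1
    nlinarith
  have hkey := key n s₀ le_rfl hnS
  -- conclusion
  calc μ.real (ufrsStrands E w z 3 s S) ≤ μ.real (ufrsStrands E w z 3 s₀ S') :=
        measureReal_mono (ufrsStrands_mono_radii hs₀s hS'S) (measure_ne_top _ _)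
    _ ≤ C₁ * (s₀ / S') ^ (1 + α₁) := hkey
    _ ≤ C₁ * ((Λ * L') * (s / S)) ^ (1 + α₁) := by
        refine mul_le_mul_of_nonneg_left (Real.rpow_le_rpow (by positivity) ?_ (by linarith)) hC₁pos.le
        rw [div_le_iff₀ hS'pos, show Λ * L' * (s / S) * S' = (Λ * s) * (L' * S') / S by ring, le_div_iff₀ hS]
        calc s₀ * S ≤ (Λ * s) * S := mul_le_mul_of_nonneg_right hs₀Λ hS.le
          _ ≤ (Λ * s) * (L' * S') := mul_le_mul_of_nonneg_left hSΛ (by positivity)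
    _ = C₁ * (Λ * L') ^ (1 + α₁) * (s / S) ^ (1 + α₁) := by
        rw [Real.mul_rpow (by positivity) (by positivity)]; ring

end

end Summit.CriticalPhenomena.CardyFormulaZ2.Cruxes.EdgePrecompact.QkzStripBoundaryArm
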